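import Summits.ResolutionOfSingularities.ResolutionOfSingularities.Theorems.HilbertSamuelEliminationSigmaMaxModificationsCorridor3SigmaRowRunPFrame
import HarnessLib

/-!
# [OURS · L1 W4.2] σ-LAYER — `Corridor3SigmaMenuGateRowPEngine`: THE GATE ↔ ENGINE SOCKET of ENGINE-I «ROW-P»: the row-data reading `RowDataReading`
# (the non-scheme fields of res-D-pv-060's `RowState` read off the σ-state), the (H1) STATE-BIT mode `RowModeReading.ofRowData`, the P-prescription
# `GroupGate.ofRowEngine` («`rowP ℓ₀ g C` :⟺ `C` = THE P-centre `γ` of the row state»), and THE ENGINE LAW AT THE GATE: a centre passing the gate of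
# record `CentreGate.ofRecordP` through a tame point of a P-row IS the engine's centre
# (cell res-hironaka, LADDER-RESOLUTION rung L; slot W4.2, crux chain w42 `SigmaMaxModifications` stmt-ResolutionOfSingularities-18506 / conjunct
# `SigmaMaxModificationsCorridor3` stmt-ResolutionOfSingularities-19249; RULING v3.14-51a (51a-F) bridge «`rowP ℓ₀ g C` :⟺ C = … `pCentre`», res-D-pv-060
# SIGNATURES 21:24:31Z (S1)/(S4) + res-L1-type-o1 SHAPE ANSWER 21:31:24Z (1)(2); typer res-L1-type-o1 g11; `--supports stmt-…-19249 --as helper`, counted 0)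

HONEST FRAMING. OURS design bookkeeping over this seat's P-MODE gate (`…Corridor3SigmaMenuGateRowP` p566992: `RowMode`, `RowModeReading`, `RowValueReading`,
`GroupGate.byRowMode`, `GroupGate.tamePrescriptionP`, `CentreGate.ofRecordP`, `ofRecordP_rowP_apply`) and res-D-pv-060's instance frame
(`…Corridor3SigmaRowRunPFrame` p574402: `RowState`, `RowEngine`, `RowEngine.γ`, `RowEngine.next`/`Move`). The two READINGS are PARAMETERS: `rd : RowDataReading`
(which rows of the state are P-rows and with which J-data / epoch split / memory bit — the run's bookkeeping; res-D-pv-002 / the instance hand) and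
`sval : RowValueReading` (res-L1-type-o2's (G2a)). NOTHING here is a statement of H. Hironaka's manuscript [Hironaka2017] nor of [Cutkosky2009]; no named
fact. AI-typed; AI review is weaker than expert review.

## Contents (namespace `…Theorems.SigmaMaxModificationsCorridor3.Sigma`)

* §1 `RowDatum W E` (`I`, `N`, `ℓ₀`, `ℓ₀_le : ℓ₀ ≤ |E|`, `after9` — the non-scheme fields of `RowState`), **`RowDatum.toRowState`** (the row state OVER THE
  σ-STATE'S OWN STAGE AND BOUNDARY: `(d.toRowState W hW E).W` is `W` by `rfl`, so centres compare without casts), `RowDataReading` (row value ↦ the served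
  P-row's datum; `none` = a MENU row).
* §2 **`RowModeReading.ofRowData rd`** — `some d ↦ rowP d.ℓ₀`, `none ↦ menu`: the (H1) STATE-BIT realisation of the P-MODE reading (`SwitchLaw` then constrains
  `rd` along runs); `ofRowData_eq_menu_iff`, `ofRowData_eq_rowP_iff`, `isP_ofRowData_iff`.
* §3 **`GroupGate.ofRowEngine m eng rd sval : ℕ → GroupGate`** — «`rowP ℓ₀ … g C` :⟺ the row of `g` (value `sval g`) carries a P-datum `d` with `d.ℓ₀ = ℓ₀` and
  `C = (eng (sval g)).γ (d.toRowState W hW E)`»; `ofRowEngine_iff`, `ofRowEngine_of_eq_γ`.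
* §4 THE ENGINE LAW AT THE GATE: **`GroupGate.tamePrescriptionP_ofRowEngine_iff`** (at a point of a P-row the P-MODE prescription holds iff `C` is the engine's
  centre) and **`CentreGate.ofRecordP_eq_γ`** (a centre passing `CentreGate.ofRecordP … (ofRowData rd) … (ofRowEngine m eng rd sval)` through a tame point
  `g` of a P-row IS `γ` of that row's state — so the σ-step there is `RowEngine.next`, the σ-side of `PIncidenceS1.IsEngineP`).

VACUITY SELF-CHECK. `ofRowEngine … ℓ₀` admits exactly ONE centre at a P-row point (the engine's) and none with the wrong epoch split; on MENU rows (`rd = none`)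
it is never consulted (`byRowMode` takes the menu branch). Not vacuous: any other centre through a tame point of a P-row is refused by `ofRecordP_eq_γ`.
-/

noncomputable section

set_option linter.dupNamespace false -- mandated namespace of this single-conjunct summit

open CategoryTheory AlgebraicGeometry TopologicalSpace
open Summit.ResolutionOfSingularities.ResolutionOfSingularities.Theorems.CampaignW42
open Summit.ResolutionOfSingularities.ResolutionOfSingularities.Theorems.SigmaMaxModificationsCorridor3.RowRunP
open Literature.AlgebraicGeometry.Resolution Literature.RingTheory.HilbertSamuel

namespace Summit.ResolutionOfSingularities.ResolutionOfSingularities.Theorems.SigmaMaxModificationsCorridor3.Sigma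

universe u

/-! ## §1 Row data over the σ-state -/

/-- [OURS · L1 W4.2] **THE DATUM OF A P-ROW at a σ-state** — the non-scheme fields of res-D-pv-060's `RowState`: the row's ideal of record `I` (threshold `m`),
its residual `N` (threshold `S₀`), the epoch split `ℓ₀ ≤ |E|` (SWITCH LAW) and the (9)→(10) memory bit. NOT a statement of the manuscript. [folklore] -/
structure RowDatum (W : Scheme.{u}) (E : Boundary W) : Type u where
  /-- the ideal of record of the row -/
  I : W.IdealSheafData
  /-- the residual ideal of the row -/
  N : W.IdealSheafData
  /-- the epoch split -/
  ℓ₀ : ℕ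
  /-- it lies inside the boundary -/
  ℓ₀_le : ℓ₀ ≤ E.length
  /-- the (9)→(10) memory bit -/
  after9 : Prop

/-- [OURS · L1 W4.2] **THE ROW STATE OVER THE σ-STATE'S OWN STAGE AND BOUNDARY**: `⟨W, hW, d.I, d.N, E, d.ℓ₀, d.ℓ₀_le, d.after9⟩`. [folklore] -/
def RowDatum.toRowState (W : Scheme.{u}) (hW : IsLocallyNoetherian W) (E : Boundary W) (d : RowDatum W E) : RowState.{u} :=
  ⟨W, hW, d.I, d.N, E, d.ℓ₀, d.ℓ₀_le, d.after9⟩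

section Datum

variable {W : Scheme.{u}} {hW : IsLocallyNoetherian W} {E : Boundary W} (d : RowDatum W E)

/-- The stage of the row state is the σ-stage (`rfl`). [folklore] -/
@[simp] theorem RowDatum.toRowState_W : (d.toRowState W hW E).W = W := rfl

/-- Its boundary is the σ-boundary (`rfl`). [folklore] -/
@[simp] theorem RowDatum.toRowState_E : (d.toRowState W hW E).E = E := rfl

/-- Its epoch split is the datum's (`rfl`). [folklore] -/
@[simp] theorem RowDatum.toRowState_ℓ₀ : (d.toRowState W hW E).ℓ₀ = d.ℓ₀ := rfl

/-- Its ideal of record (`rfl`). [folklore] -/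
@[simp] theorem RowDatum.toRowState_I : (d.toRowState W hW E).I = d.I := rfl

/-- Its residual (`rfl`). [folklore] -/
@[simp] theorem RowDatum.toRowState_N : (d.toRowState W hW E).N = d.N := rfl

/-- Its old epoch is `E.epochMinus d.ℓ₀` (`rfl`). [folklore] -/
theorem RowDatum.toRowState_Eminus : (d.toRowState W hW E).Eminus = E.epochMinus d.ℓ₀ := rfl

end Datum

/-- [OURS · L1 W4.2] **A ROW-DATA READING**: at the σ-state, the datum of the P-row of value `S₀` (`some d`), or `none` if that row is in MENU mode. The run's
bookkeeping (which rows have switched, with which `E⁻`, J-data and memory bit); constrained along runs by `SwitchLaw`. NOT a statement of the manuscript.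
[folklore] -/
abbrev RowDataReading : Type (u + 1) :=
  ∀ (W : Scheme.{u}), IsLocallyNoetherian W → ℕ → (ℕ → ℕ) → Labelling W → Option (Pending W) → (E : Boundary W) → ℕ → Option (RowDatum W E)

/-! ## §2 The (H1) state-bit mode reading -/

/-- [OURS · L1 W4.2] **THE MODE READ OFF THE ROW DATA** ((H1) STATE-BIT route, res-L1-type-o1 DESIGN NOTE 20:30:48Z): a row carrying a P-datum `d` is in mode
`rowP d.ℓ₀`; a row without one is in MENU mode. NOT a statement of the manuscript. [folklore] -/
def RowModeReading.ofRowData (rd : RowDataReading.{u}) : RowModeReading.{u} :=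
  fun W hW N ν L P E S₀ =>
    match rd W hW N ν L P E S₀ with
    | none => .menu
    | some d => .rowP d.ℓ₀

section Mode

variable {rd : RowDataReading.{u}} {W : Scheme.{u}} {hW : IsLocallyNoetherian W} {N : ℕ} {ν : ℕ → ℕ} {L : Labelling W} {P : Option (Pending W)}
  {E : Boundary W} {S₀ : ℕ}

/-- No datum ⇒ MENU. [folklore] -/
theorem RowModeReading.ofRowData_of_none (h : rd W hW N ν L P E S₀ = none) : RowModeReading.ofRowData rd W hW N ν L P E S₀ = .menu := by
  simp only [RowModeReading.ofRowData, h]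

/-- A datum `d` ⇒ mode `rowP d.ℓ₀`. [folklore] -/
theorem RowModeReading.ofRowData_of_some {d : RowDatum W E} (h : rd W hW N ν L P E S₀ = some d) :
    RowModeReading.ofRowData rd W hW N ν L P E S₀ = .rowP d.ℓ₀ := by
  simp only [RowModeReading.ofRowData, h]

/-- MENU iff no datum. [folklore] -/
theorem RowModeReading.ofRowData_eq_menu_iff : RowModeReading.ofRowData rd W hW N ν L P E S₀ = .menu ↔ rd W hW N ν L P E S₀ = none := by
  unfold RowModeReading.ofRowData
  cases rd W hW N ν L P E S₀ with
  | none => simp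
  | some d => simp

/-- Mode `rowP ℓ₀` iff a datum with epoch split `ℓ₀`. [folklore] -/
theorem RowModeReading.ofRowData_eq_rowP_iff {ℓ₀ : ℕ} :
    RowModeReading.ofRowData rd W hW N ν L P E S₀ = .rowP ℓ₀ ↔ ∃ d, rd W hW N ν L P E S₀ = some d ∧ d.ℓ₀ = ℓ₀ := by
  unfold RowModeReading.ofRowData
  cases rd W hW N ν L P E S₀ with
  | none => simp
  | some d => simp

/-- P-mode iff some datum. [folklore] -/
theorem RowModeReading.isP_ofRowData_iff : (RowModeReading.ofRowData rd W hW N ν L P E S₀).IsP ↔ ∃ d, rd W hW N ν L P E S₀ = some d := by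
  unfold RowModeReading.ofRowData
  cases rd W hW N ν L P E S₀ with
  | none => simp [RowMode.IsP]
  | some d => simp [RowMode.IsP]

end Mode

/-! ## §3 The P-prescription from the engine -/

/-- [OURS · L1 W4.2] **THE P-PRESCRIPTION OF RECORD FROM THE ENGINE** (RULING v3.14-51a (51a-F) bridge «`rowP ℓ₀ g C` :⟺ `C` = THE P-centre»): at a point `g`
whose row (value `sval g`) carries a P-datum `d` with epoch split `ℓ₀`, the admitted centre is exactly the engine's centre `(eng (sval g)).γ` of the row state
built over the σ-state; on rows without a datum, or with another split, nothing is admitted (never consulted there: `byRowMode` takes the MENU branch).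
`m` = the cell's pair order; `eng S₀` = res-D-pv-060's engine of the row of value `S₀`. NOT a statement of the manuscript. [folklore] -/
def GroupGate.ofRowEngine (m : ℕ) (eng : ∀ S₀ : ℕ, RowEngine.{u} m S₀) (rd : RowDataReading.{u}) (sval : RowValueReading.{u}) : ℕ → GroupGate.{u} :=
  fun ℓ₀ W hW N ν L P E g C =>
    ∃ d : RowDatum W E, rd W hW N ν L P E (sval W hW N ν L P E g) = some d ∧ d.ℓ₀ = ℓ₀ ∧ C = (eng (sval W hW N ν L P E g)).γ (d.toRowState W hW E)

section Engine

variable {m : ℕ} {eng : ∀ S₀ : ℕ, RowEngine.{u} m S₀} {rd : RowDataReading.{u}} {sval : RowValueReading.{u}} {W : Scheme.{u}}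
  {hW : IsLocallyNoetherian W} {N : ℕ} {ν : ℕ → ℕ} {L : Labelling W} {P : Option (Pending W)} {E : Boundary W} {g : W} {C : W.IdealSheafData} {ℓ₀ : ℕ}

/-- Unfolding (`Iff.rfl`). [folklore] -/
theorem GroupGate.ofRowEngine_iff :
    GroupGate.ofRowEngine m eng rd sval ℓ₀ W hW N ν L P E g C ↔
      ∃ d : RowDatum W E, rd W hW N ν L P E (sval W hW N ν L P E g) = some d ∧ d.ℓ₀ = ℓ₀ ∧
        C = (eng (sval W hW N ν L P E g)).γ (d.toRowState W hW E) :=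
  Iff.rfl

/-- The engine's centre passes (with the datum's split). [folklore] -/
theorem GroupGate.ofRowEngine_of_eq_γ {d : RowDatum W E} (hd : rd W hW N ν L P E (sval W hW N ν L P E g) = some d)
    (hC : C = (eng (sval W hW N ν L P E g)).γ (d.toRowState W hW E)) : GroupGate.ofRowEngine m eng rd sval d.ℓ₀ W hW N ν L P E g C :=
  ⟨d, hd, rfl, hC⟩

/-- A passing centre is the engine's centre of the row's state, and the split is the datum's. [folklore] -/
theorem GroupGate.ofRowEngine_eq_γ {d : RowDatum W E} (hd : rd W hW N ν L P E (sval W hW N ν L P E g) = some d)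
    (h : GroupGate.ofRowEngine m eng rd sval ℓ₀ W hW N ν L P E g C) : C = (eng (sval W hW N ν L P E g)).γ (d.toRowState W hW E) ∧ d.ℓ₀ = ℓ₀ := by
  obtain ⟨d', hd', hℓ, hC⟩ := h
  rw [hd] at hd'
  obtain rfl : d = d' := Option.some_injective _ hd'
  exact ⟨hC, hℓ⟩

/-! ## §4 The engine law at the gate -/

/-- **AT A POINT OF A P-ROW THE P-MODE PRESCRIPTION HOLDS IFF `C` IS THE ENGINE'S CENTRE** (mode read by `ofRowData`, prescription by `ofRowEngine`).
[folklore] -/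
theorem GroupGate.tamePrescriptionP_ofRowEngine_iff {tk : TameKindReading.{u}} {sncSurface : PointReading.{u}} {germ : TameGermReading.{u}}
    {γeS low midWild surface : GroupGate.{u}} {d : RowDatum W E} (hd : rd W hW N ν L P E (sval W hW N ν L P E g) = some d) :
    GroupGate.tamePrescriptionP sval (RowModeReading.ofRowData rd) tk sncSurface germ γeS low midWild surface (GroupGate.ofRowEngine m eng rd sval)
        W hW N ν L P E g C ↔ C = (eng (sval W hW N ν L P E g)).γ (d.toRowState W hW E) := by
  rw [GroupGate.tamePrescriptionP_of_rowP (RowModeReading.ofRowData_of_some hd)]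
  exact ⟨fun h => (GroupGate.ofRowEngine_eq_γ hd h).1, fun h => GroupGate.ofRowEngine_of_eq_γ hd h⟩

/-- [OURS · L1 W4.2] **THE ENGINE LAW AT THE GATE**: with the mode read off the row data and the prescription from the engine, a centre passing THE GATE OF
RECORD `CentreGate.ofRecordP` through a tame point `g` of a P-row IS the engine's centre `γ` of that row's state over the σ-state — so the σ-step at a
P-row is `RowEngine.next` (the σ-side of `PIncidenceS1.IsEngineP`). NOT a statement of the manuscript. [folklore] -/
theorem CentreGate.ofRecordP_eq_γ {corners tamePts : CornerReading.{u}} {face γe γeS low midWild surface : GroupGate.{u}} {kind : CornerKindReading.{u}}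
    {tk : TameKindReading.{u}} {sncSurface : PointReading.{u}} {germ : TameGermReading.{u}}
    (h : CentreGate.ofRecordP corners face kind γe tamePts sval (RowModeReading.ofRowData rd) tk sncSurface germ γeS low midWild surface
      (GroupGate.ofRowEngine m eng rd sval) W hW N ν L P E C)
    (hg : g ∈ tamePts W hW N ν L P E) (hgC : g ∈ (C.support : Set W)) {d : RowDatum W E} (hd : rd W hW N ν L P E (sval W hW N ν L P E g) = some d) :
    C = (eng (sval W hW N ν L P E g)).γ (d.toRowState W hW E) :=
  (GroupGate.ofRowEngine_eq_γ hd (CentreGate.ofRecordP_rowP_apply h hg hgC (RowModeReading.ofRowData_of_some hd))).1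

/-- … and conversely the engine's centre passes the tame half of the gate at every tame point of ITS row carrying the datum (the corner half and other rows'
points are the caller's). [folklore] -/
theorem GroupGate.tamePrescriptionP_of_eq_γ {tk : TameKindReading.{u}} {sncSurface : PointReading.{u}} {germ : TameGermReading.{u}}
    {γeS low midWild surface : GroupGate.{u}} {d : RowDatum W E} (hd : rd W hW N ν L P E (sval W hW N ν L P E g) = some d)
    (hC : C = (eng (sval W hW N ν L P E g)).γ (d.toRowState W hW E)) :
    GroupGate.tamePrescriptionP sval (RowModeReading.ofRowData rd) tk sncSurface germ γeS low midWild surface (GroupGate.ofRowEngine m eng rd sval)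
      W hW N ν L P E g C :=
  (GroupGate.tamePrescriptionP_ofRowEngine_iff hd).mpr hC

end Engine

end Summit.ResolutionOfSingularities.ResolutionOfSingularities.Theorems.SigmaMaxModificationsCorridor3.Sigma

end
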